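import Literature.RingTheory.HilbertSamuel.HilbertSamuelFunction
import Mathlib.Algebra.Module.SpanRankOperations
import HarnessLib

/-!
# The Hilbert function detects regularity: `H^{(0)}_𝒪 = Φ^{(dim 𝒪)}` iff `𝒪` is regular
# (Cossart–Jannsen–Saito 2020, Lemma 2.23, the equality clause)

Topic: `Literature/RingTheory/HilbertSamuel`. CJS, LNM 2270, Lemma 2.23: "Let `𝒪` be a
noetherian local ring of dimension `d` … Then `H^{(0)}_𝒪 ≥ Φ^{(d)}`, and equality holds if and
only if `𝒪` is regular." The direction "regular ⟹ equality" is
`hilbertFun_eq_iterPSum_Phi_of_isRegularLocalRing` (`HilbertSamuelFunction.lean`, via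
`gr_𝔪(𝒪) ≅ k[X_1, …, X_d]`). This file PROVES the converse, which is elementary once the
dimension `d = dim 𝒪` is fixed: `H^{(0)}_𝒪(1) = dim_k 𝔪/𝔪²` is the embedding dimension and
`Φ^{(d)}(1) = d`, so equality in degree `1` alone gives `emb dim 𝒪 = dim 𝒪`, i.e. regularity
(Mathlib's definition, `IsRegularLocalRing.of_spanFinrank_maximalIdeal_le`). Hence:

* `isRegularLocalRing_of_hilbertFun_one_le` — `H^{(0)}_𝒪(1) ≤ dim 𝒪 ⟹ 𝒪` regular;
* `isRegularLocalRing_iff_hilbertFun_eq` — **`𝒪` is regular iff `H^{(0)}_𝒪 = Φ^{(dim 𝒪)}`**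
  (the equality clause of Lemma 2.23), and `isRegularLocalRing_iff_hilbertSamuelFun_eq` — iff
  `H^{(t)}_𝒪 = Φ^{(t + dim 𝒪)}` for any one `t` (injectivity of `ν ↦ ν^{(t)}`).

The INEQUALITY `H^{(0)}_𝒪 ≥ Φ^{(dim 𝒪)}` for non-regular `𝒪` (graded Noether normalisation /
`dim gr_𝔪 𝒪 = dim 𝒪`) is not proved here.

## Sources

* V. Cossart, U. Jannsen, S. Saito, LNM 2270 (2020), Lemma 2.23. [CossartJannsenSaito2020]
-/

noncomputable section

open IsLocalRing

namespace Literature.RingTheory.HilbertSamuel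

universe u

variable (A : Type u) [CommRing A] [IsLocalRing A] [IsNoetherianRing A]

/-- `H^{(0)}_A(1) = emb dim A` (the minimal number of generators of `𝔪`). [folklore] -/
theorem hilbertFun_one_eq_spanFinrank : hilbertFun A 1 = (maximalIdeal A).spanFinrank := by
  rw [hilbertFun_one, spanFinrank_maximalIdeal_eq_finrank_cotangentSpace]

/-- **Regularity from the Hilbert function in degree one**: if `H^{(0)}_A(1) ≤ dim A` then `A`
is regular (`emb dim ≤ dim`; the reverse inequality is Krull's). [folklore] -/
theorem isRegularLocalRing_of_hilbertFun_one_le {d : ℕ} (hd : ringKrullDim A = d)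
    (h : hilbertFun A 1 ≤ d) : IsRegularLocalRing A := by
  apply IsRegularLocalRing.of_spanFinrank_maximalIdeal_le
  rw [hd, ← hilbertFun_one_eq_spanFinrank]
  exact_mod_cast h

/-- `Φ^{(d)}(1) = d`. [folklore] -/
theorem iterPSum_Phi_one (d : ℕ) : iterPSum d Phi 1 = d := by
  rw [iterPSum_Phi_eq_choose]
  cases d <;> simp

/-- **CJS Lemma 2.23, equality clause: a Noetherian local ring of dimension `d` is regular iff
`H^{(0)}_A = Φ^{(d)}`.** [cite: CossartJannsenSaito2020, Lemma 2.23] -/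
theorem isRegularLocalRing_iff_hilbertFun_eq {d : ℕ} (hd : ringKrullDim A = d) :
    IsRegularLocalRing A ↔ hilbertFun A = iterPSum d Phi := by
  refine ⟨fun _ => hilbertFun_eq_iterPSum_Phi_of_isRegularLocalRing A hd, fun h => ?_⟩
  refine isRegularLocalRing_of_hilbertFun_one_le A hd ?_
  rw [h, iterPSum_Phi_one]

/-- The same with any `H^{(t)}`: `A` is regular iff `H^{(t)}_A = Φ^{(t+d)}`.
[cite: CossartJannsenSaito2020, Lemma 2.23] -/
theorem isRegularLocalRing_iff_hilbertSamuelFun_eq {d : ℕ} (hd : ringKrullDim A = d) (t : ℕ) :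
    IsRegularLocalRing A ↔ hilbertSamuelFun A t = iterPSum (t + d) Phi := by
  rw [isRegularLocalRing_iff_hilbertFun_eq A hd, hilbertSamuelFun, iterPSum_add]
  exact ⟨fun h => by rw [h], fun h => iterPSum_injective t h⟩

end Literature.RingTheory.HilbertSamuel

end
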